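import Mathlib
import Literature.RepresentationTheory.FiniteGroups.WedderburnBlocks
import Literature.RepresentationTheory.FiniteGroups.IrreducibleCharacters
import Summits.MatrixMultiplication.MatrixMultiplication.Theorems.LevelGradedCohnUmansGradedPricingStubSupport
import Summits.MatrixMultiplication.MatrixMultiplication.Theorems.LevelGradedCohnUmansGradedPricingStubExpansion
import Summits.MatrixMultiplication.MatrixMultiplication.Theorems.LevelGradedCohnUmansGradedPricing
import Summits.MatrixMultiplication.MatrixMultiplication.Theorems.GradedPricing.Negative.LoadBearing

/-!
# Block containment: `Σ_{χ ∈ Irr(G) ∩ J} χ(1)² ≤ dim J` for a bi-invariant `J ≤ ℂ^G`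
# (stub `stub_blockContainment` of line `quadratic-extension-level-one-cell`,
# crux `LevelGradedCohnUmans.GradedDesignFamily`, item `stmt-MatrixMultiplication-7610`)

For a finite group `G` and a BI-INVARIANT subspace `J ≤ ℂ^G` (closed under `f ↦ (g ↦ f (a g b))`)
the graded budget at exponent `2` is at most the dimension:
`Σᶠ_{χ ∈ Irr(G) ∩ J} χ(1)² ≤ dim J` (the reverse inequality is the landed
`GradedDesignFamily.Negative.finrank_le_gradedBudget_two`).  Fix a Wedderburn isomorphism
`φ : ℂ[G] ≃ₐ ∏ᵢ ℂ^{dᵢ×dᵢ}` (`exists_algEquiv_pi_matrix`), block characters `χᵢ = tr (φ ·)ᵢ`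
(`blockRep`, `character_blockRep_apply`) and the inversion-twisted lift
`ǩ = ∑ g, single g (k g⁻¹)` of the `GradedPricing` stub files.

* `blockContainment_exists_character_eq` — COMPLETENESS: every irreducible character is a block
  character (the regular character is `∑ᵢ dᵢ χᵢ`, `sum_blockDegree_mul_trace_single`; an
  irreducible `χ` orthogonal to all `χᵢ` would have `χ(1) = ⟨r_G, χ⟩ = 0`,
  `classInner_leftRegular`, `IsIrrChar.classInner_eq`, `GradedPricing.Negative.apply_one_ne_zero`);
* `blockContainment_lift_character` — `φ(χ̌ᵢ) = (|G|/dᵢ) • eᵢ` (Fourier inversion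
  `card_mul_apply_eq_sum_trace` applied to the coefficient function of the block unit `eᵢ`);
* `blockContainment_coeff_mem` — BLOCK CONTAINMENT: `χᵢ ∈ J ⟹` every matrix coefficient
  `g ↦ (φ g)ᵢ[a,b]` lies in `J` (two-sidedness `exists_mul_lift_mul_eq` of `J̌` — the only use of
  bi-invariance — with `u = φ⁻¹(Eᵢ_ba)`, `v = 1`, then Fourier inversion again);
* `blockContainment_linearIndependent` — the `|G| = ∑ dᵢ²` matrix coefficients span `ℂ^G`
  (`stub_expansion` with every block allowed), hence are linearly independent
  (`linearIndependent_of_top_le_span_of_card_eq_finrank`);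
* `blockContainment_sum_sq_le_finrank` — so `Σ_{χᵢ ∈ J} dᵢ² ≤ dim J`, and by completeness and
  `character_blockRep_injective` the left side is `Σᶠ_{χ ∈ Irr(G) ∩ J} χ(1)²`:
  `stub_blockContainment`.
-/

set_option linter.dupNamespace false

noncomputable section

open scoped BigOperators
open Module Literature.RepresentationTheory.FiniteGroups

namespace Summit.MatrixMultiplication.MatrixMultiplication.Theorems.GradedDesignFamily

variable {G : Type} [Group G]
variable {r : ℕ} {d : Fin r → ℕ}

/-! ## Completeness of the block characters -/

/-- The block characters are irreducible characters. -/
theorem blockContainment_isIrrChar_character [Finite G] [∀ i, NeZero (d i)]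
    (φ : MonoidAlgebra ℂ G ≃ₐ[ℂ] BlockAlgebraC d) (i : Fin r) :
    IsIrrChar G (blockRep φ i).character :=
  ⟨Fin (d i) → ℂ, inferInstance, inferInstance, inferInstance, blockRep φ i,
    isIrreducible_blockRep φ i, rfl⟩

/-- The regular character is `∑ᵢ dᵢ χᵢ` (`sum_blockDegree_mul_trace_single`). -/
theorem blockContainment_leftRegular_eq_sum [Fintype G]
    (φ : MonoidAlgebra ℂ G ≃ₐ[ℂ] BlockAlgebraC d) :
    (Representation.leftRegular ℂ G).character = ∑ i, (d i : ℂ) • (blockRep φ i).character := by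
  classical
  funext g
  rw [character_leftRegular, ← sum_blockDegree_mul_trace_single φ g, Finset.sum_apply]
  refine Finset.sum_congr rfl fun i _ => ?_
  rw [Pi.smul_apply, smul_eq_mul, character_blockRep_apply]

/-- **Completeness**: every irreducible character of `G` is the character of some Wedderburn
block (otherwise it is orthogonal to every `χᵢ`, hence to the regular character `∑ dᵢ χᵢ`, so
`χ(1) = ⟨r_G, χ⟩ = 0`). -/
theorem blockContainment_exists_character_eq [Fintype G] [∀ i, NeZero (d i)]
    (φ : MonoidAlgebra ℂ G ≃ₐ[ℂ] BlockAlgebraC d) {χ : G → ℂ} (hχ : IsIrrChar G χ) :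
    ∃ i, (blockRep φ i).character = χ := by
  classical
  by_contra hne
  have h1 : classInner (Representation.leftRegular ℂ G).character χ = χ 1 :=
    classInner_leftRegular χ
  rw [blockContainment_leftRegular_eq_sum φ, classInner_sum_left] at h1
  have h0 : ∑ i, classInner ((d i : ℂ) • (blockRep φ i).character) χ = 0 := by
    refine Finset.sum_eq_zero fun i _ => ?_
    rw [classInner_smul_left, (blockContainment_isIrrChar_character φ i).classInner_eq hχ,
      if_neg (fun h => hne ⟨i, h⟩), mul_zero]
  rw [h0] at h1
  exact GradedPricing.Negative.apply_one_ne_zero hχ h1.symm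

/-! ## The Fourier transform of a block character and block containment -/

/-- **Fourier transform of a block character**: `φ(χ̌ᵢ) = (|G|/dᵢ) • eᵢ`.  With `k₀ g := eᵢ(g⁻¹)`
(coefficients of the block unit `eᵢ = φ⁻¹(Pi.single i 1)`) one has `ǩ₀ = eᵢ`, and Fourier
inversion at `1` (`card_mul_apply_eq_sum_trace`) gives `|G| k₀ = dᵢ χᵢ`. -/
theorem blockContainment_lift_character [Fintype G] [∀ i, NeZero (d i)]
    (φ : MonoidAlgebra ℂ G ≃ₐ[ℂ] BlockAlgebraC d) (i : Fin r) :
    φ (∑ g : G, MonoidAlgebra.single g ((blockRep φ i).character g⁻¹)) =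
      ((d i : ℂ)⁻¹ * Fintype.card G) • Pi.single i 1 := by
  classical
  obtain ⟨k₀, hk₀⟩ : ∃ k₀ : G → ℂ, k₀ = fun h => (φ.symm (Pi.single i 1)).coeff h⁻¹ := ⟨_, rfl⟩
  have hL0 : (∑ g : G, MonoidAlgebra.single g (k₀ g⁻¹)) = φ.symm (Pi.single i 1) := by
    simp only [hk₀, inv_inv]
    rw [← Finsupp.sum_fintype (φ.symm (Pi.single i 1)).coeff MonoidAlgebra.single
      (fun g => MonoidAlgebra.single_zero g), MonoidAlgebra.sum_coeff_single]
  have hval : ∀ g, (Fintype.card G : ℂ) * k₀ g = (d i : ℂ) * (blockRep φ i).character g := by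
    intro g
    rw [GradedPricing.card_mul_apply_eq_sum_trace φ k₀ g, hL0, AlgEquiv.apply_symm_apply,
      Finset.sum_eq_single i]
    · rw [Pi.single_eq_same, one_mul, character_blockRep_apply]
    · intro j _ hj
      rw [Pi.single_eq_of_ne hj, zero_mul, Matrix.trace_zero, mul_zero]
    · exact fun h => absurd (Finset.mem_univ i) h
  have hd : (d i : ℂ) ≠ 0 := Nat.cast_ne_zero.mpr (NeZero.ne (d i))
  have hchar : (blockRep φ i).character = ((d i : ℂ)⁻¹ * Fintype.card G) • k₀ := by
    funext g
    rw [Pi.smul_apply, smul_eq_mul, mul_assoc, hval g, ← mul_assoc, inv_mul_cancel₀ hd, one_mul]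
  rw [hchar, GradedPricing.lift_smul, map_smul, hL0, AlgEquiv.apply_symm_apply]

/-- **Block containment** (the step consuming bi-invariance): if the block character `χᵢ` lies in
the bi-invariant `J`, then so does every matrix coefficient `g ↦ (φ g)ᵢ[a,b]` of block `i`:
`φ⁻¹(Eᵢ_ba) · χ̌ᵢ · 1 = ǩ` for some `k ∈ J` (`exists_mul_lift_mul_eq`), `φ(ǩ) = (|G|/dᵢ) • Eᵢ_ba`
(`blockContainment_lift_character`), and Fourier inversion gives `k(g) = (φ g)ᵢ[a,b]`. -/
theorem blockContainment_coeff_mem [Fintype G] [∀ i, NeZero (d i)]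
    (φ : MonoidAlgebra ℂ G ≃ₐ[ℂ] BlockAlgebraC d) (J : Submodule ℂ (G → ℂ))
    (hJ : ∀ f ∈ J, ∀ a b : G, (fun g : G => f (a * g * b)) ∈ J) {i : Fin r}
    (hi : (blockRep φ i).character ∈ J) (a b : Fin (d i)) :
    (fun g : G => φ (MonoidAlgebra.single g 1) i a b) ∈ J := by
  classical
  obtain ⟨k, hkJ, hk⟩ := GradedPricing.exists_mul_lift_mul_eq J hJ
    (φ.symm (Pi.single i (Matrix.single b a 1))) 1 hi
  have hG : (Fintype.card G : ℂ) ≠ 0 := Nat.cast_ne_zero.mpr Fintype.card_ne_zero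
  have hd : (d i : ℂ) ≠ 0 := Nat.cast_ne_zero.mpr (NeZero.ne (d i))
  have hc : (d i : ℂ) * ((d i : ℂ)⁻¹ * Fintype.card G) = Fintype.card G := by
    rw [← mul_assoc, mul_inv_cancel₀ hd, one_mul]
  have hφk : φ (∑ g : G, MonoidAlgebra.single g (k g⁻¹)) =
      ((d i : ℂ)⁻¹ * Fintype.card G) • Pi.single i (Matrix.single b a 1) := by
    rw [← hk, map_mul, map_mul, map_one, mul_one, AlgEquiv.apply_symm_apply,
      blockContainment_lift_character, mul_smul_comm, ← Pi.single_mul, mul_one]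
  have hval : ∀ g, φ (MonoidAlgebra.single g 1) i a b = k g := by
    intro g
    have h := GradedPricing.card_mul_apply_eq_sum_trace φ k g
    rw [hφk, Finset.sum_eq_single i] at h
    · simp only [Pi.smul_apply, Pi.single_eq_same, smul_mul_assoc, Matrix.trace_smul,
        Matrix.trace_single_mul, smul_eq_mul, one_mul] at h
      rw [← mul_assoc, hc] at h
      exact (mul_left_cancel₀ hG h).symm
    · intro j _ hj
      rw [Pi.smul_apply, Pi.single_eq_of_ne hj, smul_zero, zero_mul, Matrix.trace_zero, mul_zero]
    · exact fun h => absurd (Finset.mem_univ i) h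
  rw [show (fun g : G => φ (MonoidAlgebra.single g 1) i a b) = k from funext hval]
  exact hkJ

/-! ## Linear independence of the matrix coefficients -/

/-- **The matrix coefficients `g ↦ (φ g)ᵢ[a,b]` of all blocks are linearly independent**: they
span `ℂ^G` (Fourier expansion at `1`, `stub_expansion` with every block allowed) and there are
`∑ᵢ dᵢ² = |G| = dim ℂ^G` of them (`sum_sq_blockDegrees_eq_card`). -/
theorem blockContainment_linearIndependent [Fintype G]
    (φ : MonoidAlgebra ℂ G ≃ₐ[ℂ] BlockAlgebraC d) :
    LinearIndependent ℂ (fun k : (Σ i : Fin r, Fin (d i) × Fin (d i)) =>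
      fun g : G => φ (MonoidAlgebra.single g 1) k.1 k.2.1 k.2.2) := by
  classical
  refine linearIndependent_of_top_le_span_of_card_eq_finrank ?_ ?_
  · intro f _
    have hf := GradedPricing.stub_expansion φ (fun _ => True) f (fun i hi => absurd trivial hi)
    unfold Literature.Computability.AlgebraicComplexity.repFun at hf
    refine (Submodule.span_le.2 ?_) hf
    rintro ψ ⟨i, a, b, rfl⟩
    exact Submodule.subset_span ⟨⟨i.1, (a, b)⟩, rfl⟩
  · rw [Module.finrank_fintype_fun_eq_card, Fintype.card_sigma, ← Nat.card_eq_fintype_card,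
      ← sum_sq_blockDegrees_eq_card φ]
    refine Finset.sum_congr rfl fun i _ => ?_
    rw [Fintype.card_prod, Fintype.card_fin, sq]

open scoped Classical in
/-- **`Σ_{χᵢ ∈ J} dᵢ² ≤ dim J`**: the matrix coefficients of the blocks whose character lies in
the bi-invariant `J` form a linearly independent family inside `J`
(`blockContainment_linearIndependent`, `blockContainment_coeff_mem`). -/
theorem blockContainment_sum_sq_le_finrank [Fintype G] [∀ i, NeZero (d i)]
    (φ : MonoidAlgebra ℂ G ≃ₐ[ℂ] BlockAlgebraC d) (J : Submodule ℂ (G → ℂ))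
    (hJ : ∀ f ∈ J, ∀ a b : G, (fun g : G => f (a * g * b)) ∈ J) :
    ∑ i : {i : Fin r // (blockRep φ i).character ∈ J}, d i.1 ^ 2 ≤ Module.finrank ℂ J := by
  classical
  let ι := {i : Fin r // (blockRep φ i).character ∈ J}
  let F : (Σ i : Fin r, Fin (d i) × Fin (d i)) → (G → ℂ) := fun k g =>
    φ (MonoidAlgebra.single g 1) k.1 k.2.1 k.2.2
  let emb : (Σ i : ι, Fin (d i.1) × Fin (d i.1)) → (Σ i : Fin r, Fin (d i) × Fin (d i)) :=
    Sigma.map Subtype.val fun _ => id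
  have hemb : Function.Injective emb :=
    Subtype.val_injective.sigma_map fun _ => Function.injective_id
  have hli : LinearIndependent ℂ (F ∘ emb) := (blockContainment_linearIndependent φ).comp emb hemb
  have hle : Submodule.span ℂ (Set.range (F ∘ emb)) ≤ J := by
    rw [Submodule.span_le]
    rintro ψ ⟨k, rfl⟩
    exact blockContainment_coeff_mem φ J hJ k.1.2 k.2.1 k.2.2
  calc ∑ i : ι, d i.1 ^ 2 = Fintype.card (Σ i : ι, Fin (d i.1) × Fin (d i.1)) := by
        rw [Fintype.card_sigma]
        exact Finset.sum_congr rfl fun i _ => by rw [Fintype.card_prod, Fintype.card_fin, sq]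
    _ = Module.finrank ℂ (Submodule.span ℂ (Set.range (F ∘ emb))) := (finrank_span_eq_card hli).symm
    _ ≤ Module.finrank ℂ J := Submodule.finrank_mono hle

/-! ## The registered stub -/

/-- **`stub_blockContainment`** (crux `LevelGradedCohnUmans.GradedDesignFamily`, line
`quadratic-extension-level-one-cell`): for a finite group `G` and a bi-invariant `J ≤ ℂ^G`,
`Σᶠ_{χ ∈ Irr(G) ∩ J} χ(1)² ≤ dim J`.  By completeness (`blockContainment_exists_character_eq`)
and `character_blockRep_injective` the left side is `Σ_{χᵢ ∈ J} dᵢ²`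
(`Representation.char_one`), bounded by `blockContainment_sum_sq_le_finrank`. -/
theorem stub_blockContainment :
    ∀ (G : Type) [Group G] [Fintype G] (J : Submodule ℂ (G → ℂ)),
      (∀ f ∈ J, ∀ a b : G, (fun g : G => f (a * g * b)) ∈ J) →
        (∑ᶠ χ ∈ Literature.RepresentationTheory.FiniteGroups.irrChars G ∩ (J : Set (G → ℂ)),
            (χ 1).re ^ (2 : ℝ)) ≤ (Module.finrank ℂ J : ℝ) := by
  intro G _ _ J hJ
  classical
  obtain ⟨r, d, hd, ⟨φ⟩⟩ := exists_algEquiv_pi_matrix G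
  haveI := hd
  have hfin : (irrChars G ∩ (J : Set (G → ℂ))).Finite :=
    (irrChars_finite_holds G).subset Set.inter_subset_left
  rw [finsum_mem_eq_finite_toFinset_sum _ hfin]
  set χ : {i : Fin r // (blockRep φ i).character ∈ J} → (G → ℂ) :=
    fun i => (blockRep φ i.1).character with hχ
  have hinj : Function.Injective χ := fun i j h =>
    Subtype.ext (character_blockRep_injective φ h)
  have hset : hfin.toFinset = Finset.univ.image χ := by
    ext ψ
    rw [hfin.mem_toFinset, Finset.mem_image]
    constructor
    · rintro ⟨hψ, hψJ⟩
      obtain ⟨i, rfl⟩ := blockContainment_exists_character_eq φ hψ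
      exact ⟨⟨i, hψJ⟩, Finset.mem_univ _, rfl⟩
    · rintro ⟨i, -, rfl⟩
      exact ⟨blockContainment_isIrrChar_character φ i.1, i.2⟩
  have hdeg : ∀ i, ((χ i 1).re : ℝ) = d i.1 := fun i => by
    simp [hχ, Representation.char_one]
  rw [hset, Finset.sum_image fun i _ j _ h => hinj h]
  have hle := blockContainment_sum_sq_le_finrank φ J hJ
  calc ∑ i, (χ i 1).re ^ (2 : ℝ) = ((∑ i : {i : Fin r // (blockRep φ i).character ∈ J},
        d i.1 ^ 2 : ℕ) : ℝ) := by
        push_cast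
        exact Finset.sum_congr rfl fun i _ => by rw [hdeg, Real.rpow_two]
    _ ≤ (Module.finrank ℂ J : ℝ) := by exact_mod_cast hle

end Summit.MatrixMultiplication.MatrixMultiplication.Theorems.GradedDesignFamily

end
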